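import Summits.Langlands.Langlands.Theses.ParityBlindBianchi
import Summits.Langlands.Langlands.Theorems.IcosahedralDescentLevel.Negative.AllParityOfDoorOfDescent

/-!
# `ResidualBianchiDoorLevelBC` (E1″, stmt-Langlands-16853): the two conjuncts on the bad set `S₀`
# — `0 ∉ S₀` is exactly non-vacuity of the congruence clause, `2 ∈ S₀` is decoration

Negative-side lemmas (refuter cdisprove seat, 2026-08-17; support stmt-Langlands-16853; nothing here
refutes the crux, which is proved by the picked line modulo the cited fact `khare_wintenberger 2`).

The conclusion of E1″ reads `∃ S₀ : Finset ℕ, 2 ∈ S₀ ∧ (0 : ℕ) ∉ S₀ ∧ ∀ K …, ∀ v, (∀ ℓ ∈ S₀,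
(ℓ : 𝓞 K) ∉ v.asIdeal) → congruence at v`.

* `finite_bad_places`, `infinite_good_places`, `exists_good_place_iff` — for ANY number field `K`
  and `S₀ : Finset ℕ`: a good place exists iff `0 ∉ S₀`, and then all but finitely many places are
  good.  So `0 ∉ S₀` is precisely what separates E1″ (and E1′R, stmt-16621) from the vacuous sibling
  E1′ (stmt-15112, witnessed by `S₀ = {0, 2}`: landed
  `IcosahedralDescentLevel.Negative.no_good_place_of_zero_mem`,
  `ResidualBianchiDoorLevel.Negative.not_regAlgCuspidalExist_of_not_residualBianchiDoorLevel`): every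
  witness of E1″ makes the congruence bite at infinitely many places of every admissible `K`.
* `not_withoutTwoMem_of_not_residualBianchiDoorLevelBC` — mutation, contrapositive shape: refuting E1″
  is the same as refuting its variant with the conjunct `2 ∈ S₀` DELETED (a witness `S₀ ∌ 0` can always
  be enlarged to `insert 2 S₀`: fewer good places, weaker demand).  Hence `2 ∈ S₀` is NOT load-bearing
  for the truth of the statement; it is load-bearing only inside the proof (the HLTT congruence
  normalisation needs odd residue characteristic, landed
  `ResidualBianchiDoorLevel.Negative.stub_predictedPolyCongr_false_without_odd`) and downstream (E2′).
-/

noncomputable section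

set_option linter.dupNamespace false

namespace Summit.Langlands.Langlands.Theorems.ResidualBianchiDoorLevelBC.Negative

open scoped MatrixGroups NumberField
open NumberField IsDedekindDomain Field
open Literature.NumberTheory.Automorphic Literature.NumberTheory.GaloisRepresentations
  Summit.Langlands.Langlands.Theses.ParityBlindBianchi

/-! ## `0 ∉ S₀`: the exact non-vacuity condition -/

/-- **Bad places are finite when `0 ∉ S₀`.**  Each `ℓ ∈ S₀` is then a non-zero natural, so
`(ℓ) ⊆ 𝓞 K` is a non-zero ideal with finitely many prime factors (`Ideal.finite_factors`), and a place
is bad iff it divides one of them. [folklore] -/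
theorem finite_bad_places (K : Type) [Field K] [NumberField K] {S₀ : Finset ℕ} (h0 : (0 : ℕ) ∉ S₀) :
    {v : HeightOneSpectrum (𝓞 K) | ¬ ∀ ℓ ∈ S₀, ((ℓ : ℕ) : 𝓞 K) ∉ v.asIdeal}.Finite := by
  have hsub : {v : HeightOneSpectrum (𝓞 K) | ¬ ∀ ℓ ∈ S₀, ((ℓ : ℕ) : 𝓞 K) ∉ v.asIdeal} ⊆
      ⋃ ℓ ∈ S₀, {v : HeightOneSpectrum (𝓞 K) | v.asIdeal ∣ Ideal.span {((ℓ : ℕ) : 𝓞 K)}} := by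
    intro v hv
    simp only [Set.mem_setOf_eq, not_forall, not_not, exists_prop] at hv
    obtain ⟨ℓ, hℓ, hmem⟩ := hv
    refine Set.mem_biUnion hℓ ?_
    simp only [Set.mem_setOf_eq, Ideal.dvd_span_singleton]
    exact hmem
  refine Set.Finite.subset (Set.Finite.biUnion S₀.finite_toSet fun ℓ hℓ => ?_) hsub
  apply Ideal.finite_factors
  have hℓ0 : (ℓ : ℕ) ≠ 0 := fun h => h0 (h ▸ hℓ)
  have hne : Ideal.span {((ℓ : ℕ) : 𝓞 K)} ≠ ⊥ := by
    rw [Ne, Ideal.span_singleton_eq_bot]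
    exact_mod_cast hℓ0
  simpa only [Ne, Submodule.zero_eq_bot] using hne

/-- **Good places are infinite when `0 ∉ S₀`**: the complement of a finite set in the infinite set of
finite places of a number field (`Literature.NumberTheory.Automorphic.infinite_heightOneSpectrum`).
[folklore] -/
theorem infinite_good_places (K : Type) [Field K] [NumberField K] {S₀ : Finset ℕ}
    (h0 : (0 : ℕ) ∉ S₀) :
    {v : HeightOneSpectrum (𝓞 K) | ∀ ℓ ∈ S₀, ((ℓ : ℕ) : 𝓞 K) ∉ v.asIdeal}.Infinite := by
  haveI := Literature.NumberTheory.Automorphic.infinite_heightOneSpectrum K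
  have hfin := finite_bad_places K h0
  have hcompl : {v : HeightOneSpectrum (𝓞 K) | ∀ ℓ ∈ S₀, ((ℓ : ℕ) : 𝓞 K) ∉ v.asIdeal}ᶜ =
      {v : HeightOneSpectrum (𝓞 K) | ¬ ∀ ℓ ∈ S₀, ((ℓ : ℕ) : 𝓞 K) ∉ v.asIdeal} := by
    ext v; simp only [Set.mem_compl_iff, Set.mem_setOf_eq]
  exact Set.infinite_of_finite_compl (hcompl ▸ hfin)

/-- **`(∃ good place) ↔ 0 ∉ S₀`** — the dividing line between the honest E1″/E1′R and the vacuous E1′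
(`no_good_place_of_zero_mem`, landed under `IcosahedralDescentLevel.Negative`). [folklore] -/
theorem exists_good_place_iff (K : Type) [Field K] [NumberField K] (S₀ : Finset ℕ) :
    (∃ v : HeightOneSpectrum (𝓞 K), ∀ ℓ ∈ S₀, ((ℓ : ℕ) : 𝓞 K) ∉ v.asIdeal) ↔ (0 : ℕ) ∉ S₀ := by
  refine ⟨fun ⟨v, hv⟩ h0 => IcosahedralDescentLevel.Negative.no_good_place_of_zero_mem h0 K v hv,
    fun h0 => ?_⟩
  obtain ⟨v, hv⟩ := (infinite_good_places K h0).nonempty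
  exact ⟨v, hv⟩

/-! ## `2 ∈ S₀`: decoration as a statement -/

/-- **Mutation, `2 ∈ S₀` deleted (contrapositive shape).**  Refuting E1″ is the same as refuting the
variant below (E1″ verbatim with the conclusion conjunct `2 ∈ S₀ ∧` removed): from a witness `S₀` of the
variant, `insert 2 S₀` witnesses E1″ (`0 ≠ 2`, and every place good for `insert 2 S₀` is good for
`S₀`).  So the conjunct is not load-bearing for the truth value of the crux. [folklore] -/
theorem not_withoutTwoMem_of_not_residualBianchiDoorLevelBC (h : ¬ ResidualBianchiDoorLevelBC) :
    ¬ (QuadraticBaseChangeGL2 → ∀ (ι : PadicAlgCl 2 ≃+* ℂ) (ρ : FramedGaloisRep ℚ ℂ 2),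
      ρ.toGaloisRep.IsIrreducible →
      Nonempty ((Matrix.ProjGenLinGroup.mk.comp ρ.toMonoidHom).range ≃* alternatingGroup (Fin 5)) →
      ∃ S₀ : Finset ℕ, (0 : ℕ) ∉ S₀ ∧ ∀ (K : Type) [Field K] [NumberField K],
        IsTotallyComplex K → Module.finrank ℚ K = 2 →
        (∃ v w : HeightOneSpectrum (𝓞 K), v ≠ w ∧ ((2 : ℕ) : 𝓞 K) ∈ v.asIdeal ∧
          ((2 : ℕ) : 𝓞 K) ∈ w.asIdeal) →
        ∃ σ : FramedGaloisRep K (PadicAlgCl 2) 2,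
          (∀ (g : absoluteGaloisGroup K) (i j : Fin 2),
            ι ((σ g).val i j) = ((FramedGaloisRep.restrictField K ρ) g).val i j) ∧
          Finite σ.toMonoidHom.range ∧ σ.toGaloisRep.IsIrreducible ∧
          Nonempty ((Matrix.ProjGenLinGroup.mk.comp σ.toMonoidHom).range ≃*
            alternatingGroup (Fin 5)) ∧
          ∃ (hcpt : isCompact_glFiniteIntegralLevel 2 K)
            (π₀ : CuspidalAutomorphicRepData 2 K hcpt), π₀.1.IsRegularAlgebraic ∧
            ∀ v : HeightOneSpectrum (𝓞 K), (∀ ℓ ∈ S₀, ((ℓ : ℕ) : 𝓞 K) ∉ v.asIdeal) →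
              ∃ (α : Multiset ℂ) (P : Polynomial (PadicAlgCl 2)), π₀.1.HasSatakeParamAt v α ∧
                σ.IsUnramifiedAt v ∧ σ.HasFrobCharpolyAt v P ∧
                ∀ i : ℕ, ‖P.coeff i - (arithFrobPolyOfSatake ι v.residueCard 2 α).coeff i‖ < 1) := by
  intro hW
  apply h
  intro hQ ι ρ hirr hA5
  obtain ⟨S₀, h0, hK⟩ := hW hQ ι ρ hirr hA5
  refine ⟨insert 2 S₀, Finset.mem_insert_self _ _, ?_, fun K _ _ htc hdeg hsplit => ?_⟩
  · rw [Finset.mem_insert, not_or]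
    exact ⟨by decide, h0⟩
  · obtain ⟨σ, hmodel, hfin, hirrK, hA5K, hcpt, π₀, hRA, hgood⟩ := hK K htc hdeg hsplit
    exact ⟨σ, hmodel, hfin, hirrK, hA5K, hcpt, π₀, hRA,
      fun v hv => hgood v fun ℓ hℓ => hv ℓ (Finset.mem_insert_of_mem hℓ)⟩

end Summit.Langlands.Langlands.Theorems.ResidualBianchiDoorLevelBC.Negative

end
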